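import Summits.KontsevichZagierPeriods.KontsevichZagierPeriods.Theses.UnfoldedStokes

/-!
# Route KontsevichZagierPeriods/UnfoldedStokes — `Assembly`: the route's items imply the summit

Problem `KontsevichZagierPeriods`, route `UnfoldedStokes`, item stmt-KontsevichZagierPeriods-3525
(`Assembly`, assembly, rank 1). The route declaration `Assembly` is the curried implication
`UnfoldedStokesSquare → LegendreCubicForm → HyperellipticRiemannRelation → LegendreAllModuli →
StokesGeneration → KontsevichZagierPeriods`.

The proof is pure bookkeeping over the Kontsevich–Zagier calculus of moves
(`Literature.NumberTheory.Transcendental.KZCalculus`):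
* the summit `KontsevichZagierPeriods` (= `Literature.Periods.KZPeriodConjecture`) asks, for two
  rational-shape representations `r, r'` with `r.value = r'.value`, that `KZ.Equivalent r r'`, i.e.
  `[r] - [r'] ∈ KZ.relations`;
* equal values give `KZ.eval ([r] - [r']) = 0` (`map_sub`, `KZ.eval_of`), so the engine crux
  `StokesGeneration` (Stokes generation of the kernel: `ker KZ.eval ≤ KZ.relations ⊔ closure S`,
  `S` = the set of unfolded-Stokes square relators) puts `[r] - [r']` in `KZ.relations ⊔ closure S`;
* the crux `UnfoldedStokesSquare` says precisely `S ⊆ KZ.relations`, hence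
  `closure S ≤ KZ.relations` (`AddSubgroup.closure_le`) and the sup collapses to `KZ.relations`.

The three calibration cruxes `LegendreCubicForm`, `HyperellipticRiemannRelation`,
`LegendreAllModuli` are hypotheses of the route declaration but are not consumed by the
implication (they are the route's test sectors, not load-bearing for the assembly); the
rationality hypotheses on `r, r'` are not used either. The term is the same as the route's
deciding theorem `UnfoldedStokes.closes`, re-proved here self-containedly so that the item is
closed by a `Theorems` declaration whose type is literally the route declaration.

Sources: M. Kontsevich, D. Zagier, *Periods* (2001), §1.2 (Conjecture 1, rules 1–3, and the
kernel reformulation); A. Huber, S. Müller-Stach, *Periods and Nori Motives* (2017), §13.1.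
Deliberately NOT here: any claim about the five hypotheses themselves — the result is the
implication only (unconditional as an implication; `StokesGeneration` is period-conjecture
strength and open).
-/

namespace Summit.KontsevichZagierPeriods.UnfoldedStokes

open Summit.KontsevichZagierPeriods.KontsevichZagierPeriods.Theses.UnfoldedStokes

/-- Settles stmt-KontsevichZagierPeriods-3525: the route declaration `UnfoldedStokes.Assembly`
(`UnfoldedStokesSquare → LegendreCubicForm → HyperellipticRiemannRelation → LegendreAllModuli →
StokesGeneration → KontsevichZagierPeriods`) holds. For representations `r, r'` with equal values,
`KZ.eval ([r] - [r']) = 0`; `StokesGeneration` puts `[r] - [r']` in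
`KZ.relations ⊔ AddSubgroup.closure S` with `S` the unfolded-Stokes square relators, and
`UnfoldedStokesSquare` gives `S ⊆ KZ.relations`, so `AddSubgroup.closure S ≤ KZ.relations` and
`[r] - [r'] ∈ KZ.relations`, i.e. `KZ.Equivalent r r'`. The three elliptic / hyperelliptic
calibration hypotheses are not used. [Kontsevich–Zagier 2001, §1.2] [folklore] -/
theorem assembly_proof :
    Summit.KontsevichZagierPeriods.KontsevichZagierPeriods.Theses.UnfoldedStokes.Assembly := by
  unfold Summit.KontsevichZagierPeriods.KontsevichZagierPeriods.Theses.UnfoldedStokes.Assembly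
  intro hU _hL _hH _hM hK n m r r' _ _ hv
  -- equal values: the formal difference is in the kernel of `KZ.eval`
  have h0 : Literature.NumberTheory.Transcendental.KZ.eval
      (Literature.NumberTheory.Transcendental.KZ.of r -
        Literature.NumberTheory.Transcendental.KZ.of r') = 0 := by
    rw [map_sub, Literature.NumberTheory.Transcendental.KZ.eval_of,
      Literature.NumberTheory.Transcendental.KZ.eval_of, hv, sub_self]
  -- Stokes generation: the difference lies in `relations ⊔ closure S`
  have hmem := hK _ h0
  -- it suffices that `closure S ≤ relations`, i.e. `S ⊆ relations`
  have hsub : ∀ (A B : AddSubgroup Literature.NumberTheory.Transcendental.KZ.FormalRep),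
      B ≤ A → ∀ x, x ∈ A ⊔ B → x ∈ A := fun A B h x hx => (sup_le le_rfl h) hx
  refine hsub _ _ ((AddSubgroup.closure_le _).mpr ?_) _ hmem
  -- which is exactly the crux `UnfoldedStokesSquare`, relator by relator
  rintro d ⟨U, a, b, c, e, rB, rR, rT, rL, rW, rD, hUo, hUI, hUs, ha, hb, hc, he, hcl, sa, sb, sc,
    se, sa0, sa1, sb1, sc1, se0, hBd, hBi, hRd, hRi, hTd, hTi, hLd, hLi, hWd, hWi, hDd, hDi, rfl⟩
  exact hU U a b c e hUo hUI hUs ha hb hc he hcl sa sb sc se sa0 sa1 sb1 sc1 se0 rB rR rT rL rW rD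
    hBd hBi hRd hRi hTd hTi hLd hLi hWd hWi hDd hDi

end Summit.KontsevichZagierPeriods.UnfoldedStokes
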